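import Summits.KontsevichZagierPeriods.KontsevichZagierPeriods.Theorems.SymplecticScissorsVolumeFormOffPlaneUnionSplit

/-!
# `VolumeFormOffPlane` (stmt-KontsevichZagierPeriods-14935) — line `Sketch`,
stub `stub_pairsOfDecomposition` (pairs from signed decompositions)

The composition step of the line's v6 "signed scissors" layer for the Kontsevich–Zagier
calculus (`Literature/NumberTheory/Transcendental/KZCalculus.lean`). Given, in dimension `N`,

* the SCISSORS LEMMA (taken as a hypothesis): an a.e. identity `Σᵢ εᵢ·1_{ρᵢ.domain} = 0` between
  integrand-`1` representations forces `Σᵢ εᵢ • [ρᵢ] ∈ relations`, and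
* the `ℤ`-WEIGHTED FAMILY PROPERTY of two classes `GB`, `GS` (taken as a hypothesis): a
  `ℤ`-weighted combination of members (`GB`/`GS` wherever the weight is non-zero) of total
  weighted value `0` is a relation,

two integrand-`1` representations `r`, `r'` whose domain indicators are, almost everywhere,
`ℤ`-combinations of domain indicators of integrand-`1` cells, and whose values agree, are
KZ-equivalent:

1. `pod_of_sub_comb_mem_relations`: the scissors lemma applied to the family `r, ρB, ρS` with
   weights `1, -cB, -cS` (assembled with `Matrix.vecCons` / `Fin.append`) gives
   `[r] − (Σ cB•[ρB] + Σ cS•[ρS]) ∈ relations`;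
2. `pod_value_eq_of_sub_comb_mem`: soundness (`KZ.relations_le_ker_eval_holds`) turns this into
   `value r = Σ cB·value ρB + Σ cS·value ρS`;
3. `pod_comb_sub_comb_mem_relations`: the weighted family property applied to the concatenated
   families (`Fin.append`, the second copy with negated weights) gives the congruence of the two
   cell combinations once their weighted values agree;
4. `stub_pairsOfDecomposition` combines the three memberships in the subgroup `relations`.

Sources: Kontsevich–Zagier 2001, §1.2 (the calculus and its soundness); the rest is bookkeeping.
-/

noncomputable section

open MeasureTheory Set
open Literature.NumberTheory.Transcendental

namespace Summit.KontsevichZagierPeriods.SymplecticScissors.LogPolytope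

/-- **Scissors, combination form.** If the scissors lemma holds in dimension `N` and the domain
indicator of an integrand-`1` representation `r` is a.e. the `ℤ`-combination
`Σ cB·1_{ρB} + Σ cS·1_{ρS}` of domain indicators of integrand-`1` representations, then
`[r] − (Σ cB•[ρB] + Σ cS•[ρS])` is a KZ-relation (the scissors lemma for the family `r, ρB, ρS`
with weights `1, -cB, -cS`). [folklore] -/
theorem pod_of_sub_comb_mem_relations {N : ℕ}
    (hsc : ∀ (k : ℕ) (ρ : Fin k → KZ.IntegralRep N) (ε : Fin k → ℤ),
      (∀ i, ∀ x ∈ (ρ i).domain, (ρ i).integrand x = 1) →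
      (∀ᵐ x : Fin N → ℝ, ∑ i, (ε i : ℝ) * (ρ i).domain.indicator (fun _ => (1 : ℝ)) x = 0) →
      ∑ i, ε i • KZ.of (ρ i) ∈ KZ.relations)
    {r : KZ.IntegralRep N} {k m : ℕ} {ρB : Fin k → KZ.IntegralRep N}
    {ρS : Fin m → KZ.IntegralRep N} {cB : Fin k → ℤ} {cS : Fin m → ℤ}
    (hr : ∀ x ∈ r.domain, r.integrand x = 1)
    (hρB : ∀ i, ∀ x ∈ (ρB i).domain, (ρB i).integrand x = 1)
    (hρS : ∀ ν, ∀ x ∈ (ρS ν).domain, (ρS ν).integrand x = 1)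
    (hae : ∀ᵐ x : Fin N → ℝ, r.domain.indicator (fun _ => (1 : ℝ)) x =
      ∑ i, (cB i : ℝ) * (ρB i).domain.indicator (fun _ => (1 : ℝ)) x +
        ∑ ν, (cS ν : ℝ) * (ρS ν).domain.indicator (fun _ => (1 : ℝ)) x) :
    KZ.of r - (∑ i, cB i • KZ.of (ρB i) + ∑ ν, cS ν • KZ.of (ρS ν)) ∈ KZ.relations := by
  set ρ : Fin (k + m + 1) → KZ.IntegralRep N := Matrix.vecCons r (Fin.append ρB ρS) with hρ
  set ε : Fin (k + m + 1) → ℤ :=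
    Matrix.vecCons 1 (Fin.append (fun i => -cB i) (fun ν => -cS ν)) with hε
  have h1 : ∀ i, ∀ x ∈ (ρ i).domain, (ρ i).integrand x = 1 := by
    intro i
    refine Fin.cases ?_ (fun j => ?_) i
    · simpa [hρ] using hr
    · refine Fin.addCases (fun a => ?_) (fun b => ?_) j
      · simpa [hρ] using hρB a
      · simpa [hρ] using hρS b
  have h2 : ∀ᵐ x : Fin N → ℝ,
      ∑ i, (ε i : ℝ) * (ρ i).domain.indicator (fun _ => (1 : ℝ)) x = 0 := by
    refine hae.mono fun x hx => ?_
    rw [Fin.sum_univ_succ, Fin.sum_univ_add]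
    simp only [hρ, hε, Matrix.cons_val_zero, Matrix.cons_val_succ, Fin.append_left,
      Fin.append_right, Int.cast_one, one_mul, Int.cast_neg, neg_mul, Finset.sum_neg_distrib, hx]
    abel
  have h3 := hsc (k + m + 1) ρ ε h1 h2
  rw [Fin.sum_univ_succ, Fin.sum_univ_add] at h3
  simp only [hρ, hε, Matrix.cons_val_zero, Matrix.cons_val_succ, Fin.append_left,
    Fin.append_right, one_zsmul, neg_zsmul, Finset.sum_neg_distrib] at h3
  convert h3 using 1
  abel

/-- **Soundness, combination form.** If `[r] − (Σ cB•[ρB] + Σ cS•[ρS])` is a KZ-relation, then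
`value r = Σ cB·value ρB + Σ cS·value ρS` (`KZ.relations_le_ker_eval_holds`: relations lie in the
kernel of the evaluation `KZ.eval`, which is additive with `KZ.eval [ρ] = value ρ`).
[Kontsevich–Zagier 2001, §1.2; folklore] -/
theorem pod_value_eq_of_sub_comb_mem {N : ℕ} {r : KZ.IntegralRep N} {k m : ℕ}
    {ρB : Fin k → KZ.IntegralRep N} {ρS : Fin m → KZ.IntegralRep N}
    {cB : Fin k → ℤ} {cS : Fin m → ℤ}
    (h : KZ.of r - (∑ i, cB i • KZ.of (ρB i) + ∑ ν, cS ν • KZ.of (ρS ν)) ∈ KZ.relations) :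
    r.value = ∑ i, (cB i : ℝ) * (ρB i).value + ∑ ν, (cS ν : ℝ) * (ρS ν).value := by
  have h0 := KZ.relations_le_ker_eval_holds h
  rw [AddMonoidHom.mem_ker, map_sub, map_add, map_sum, map_sum, KZ.eval_of, sub_eq_zero] at h0
  simpa only [map_zsmul, KZ.eval_of, zsmul_eq_mul] using h0

/-- **Weighted families, difference form.** If the classes `GB`, `GS` have the `ℤ`-weighted
family property, then two `ℤ`-weighted combinations of members (`GB`/`GS` wherever the weight is
non-zero) with equal weighted values are congruent modulo KZ-relations (the property applied to
the concatenated families, the second copy carrying the negated weights). [folklore] -/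
theorem pod_comb_sub_comb_mem_relations {N : ℕ} {GB GS : KZ.IntegralRep N → Prop}
    (hw : ∀ (k m : ℕ) (ρB : Fin k → KZ.IntegralRep N) (ρS : Fin m → KZ.IntegralRep N)
        (cB : Fin k → ℤ) (cS : Fin m → ℤ),
      (∀ i, cB i ≠ 0 → GB (ρB i)) → (∀ ν, cS ν ≠ 0 → GS (ρS ν)) →
      ∑ i, (cB i : ℝ) * (ρB i).value + ∑ ν, (cS ν : ℝ) * (ρS ν).value = 0 →
      ∑ i, cB i • KZ.of (ρB i) + ∑ ν, cS ν • KZ.of (ρS ν) ∈ KZ.relations)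
    {k m k' m' : ℕ} {ρB : Fin k → KZ.IntegralRep N} {ρS : Fin m → KZ.IntegralRep N}
    {ρB' : Fin k' → KZ.IntegralRep N} {ρS' : Fin m' → KZ.IntegralRep N}
    {cB : Fin k → ℤ} {cS : Fin m → ℤ} {cB' : Fin k' → ℤ} {cS' : Fin m' → ℤ}
    (hGB : ∀ i, cB i ≠ 0 → GB (ρB i)) (hGS : ∀ ν, cS ν ≠ 0 → GS (ρS ν))
    (hGB' : ∀ i, cB' i ≠ 0 → GB (ρB' i)) (hGS' : ∀ ν, cS' ν ≠ 0 → GS (ρS' ν))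
    (hv : ∑ i, (cB i : ℝ) * (ρB i).value + ∑ ν, (cS ν : ℝ) * (ρS ν).value =
      ∑ i, (cB' i : ℝ) * (ρB' i).value + ∑ ν, (cS' ν : ℝ) * (ρS' ν).value) :
    (∑ i, cB i • KZ.of (ρB i) + ∑ ν, cS ν • KZ.of (ρS ν)) -
      (∑ i, cB' i • KZ.of (ρB' i) + ∑ ν, cS' ν • KZ.of (ρS' ν)) ∈ KZ.relations := by
  have hB : ∀ i, Fin.append cB (fun j => -cB' j) i ≠ 0 → GB (Fin.append ρB ρB' i) := by
    intro i
    refine Fin.addCases (fun a => ?_) (fun b => ?_) i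
    · simpa using hGB a
    · simpa using hGB' b
  have hS : ∀ ν, Fin.append cS (fun j => -cS' j) ν ≠ 0 → GS (Fin.append ρS ρS' ν) := by
    intro ν
    refine Fin.addCases (fun a => ?_) (fun b => ?_) ν
    · simpa using hGS a
    · simpa using hGS' b
  have hval : ∑ i, ((Fin.append cB (fun j => -cB' j) i : ℤ) : ℝ) * (Fin.append ρB ρB' i).value +
      ∑ ν, ((Fin.append cS (fun j => -cS' j) ν : ℤ) : ℝ) * (Fin.append ρS ρS' ν).value = 0 := by
    rw [Fin.sum_univ_add, Fin.sum_univ_add]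
    simp only [Fin.append_left, Fin.append_right, Int.cast_neg, neg_mul, Finset.sum_neg_distrib]
    linarith
  have h := hw (k + k') (m + m') (Fin.append ρB ρB') (Fin.append ρS ρS')
    (Fin.append cB (fun j => -cB' j)) (Fin.append cS (fun j => -cS' j)) hB hS hval
  rw [Fin.sum_univ_add, Fin.sum_univ_add] at h
  simp only [Fin.append_left, Fin.append_right, neg_zsmul, Finset.sum_neg_distrib] at h
  convert h using 1
  abel

/-- **Stub v6-3 (PAIRS FROM SIGNED DECOMPOSITIONS).** Given the scissors lemma (v6-1) in
dimension `N` and the `ℤ`-weighted family property (v6-2) for two classes `GB`, `GS`: two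
integrand-`1` representations whose domains are, almost everywhere, `ℤ`-combinations of indicator
functions of integrand-`1` cells (`GB`/`GS` wherever the coefficient is non-zero), and whose values
agree, are KZ-equivalent (`[r] ≡ Σ c•[cell]` by scissors; weighted values agree by soundness
`relations_le_ker_eval_holds`; the two cell combinations are congruent by v6-2). [folklore] -/
theorem stub_pairsOfDecomposition : ∀ (N : ℕ) (GB GS : KZ.IntegralRep N → Prop),
    (∀ (k : ℕ) (ρ : Fin k → KZ.IntegralRep N) (ε : Fin k → ℤ),
      (∀ i, ∀ x ∈ (ρ i).domain, (ρ i).integrand x = 1) →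
      (∀ᵐ x : Fin N → ℝ, ∑ i, (ε i : ℝ) * (ρ i).domain.indicator (fun _ => (1 : ℝ)) x = 0) →
      ∑ i, ε i • KZ.of (ρ i) ∈ KZ.relations) →
    (∀ (k m : ℕ) (ρB : Fin k → KZ.IntegralRep N) (ρS : Fin m → KZ.IntegralRep N)
        (cB : Fin k → ℤ) (cS : Fin m → ℤ),
      (∀ i, cB i ≠ 0 → GB (ρB i)) → (∀ ν, cS ν ≠ 0 → GS (ρS ν)) →
      ∑ i, (cB i : ℝ) * (ρB i).value + ∑ ν, (cS ν : ℝ) * (ρS ν).value = 0 →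
      ∑ i, cB i • KZ.of (ρB i) + ∑ ν, cS ν • KZ.of (ρS ν) ∈ KZ.relations) →
    ∀ (r r' : KZ.IntegralRep N) (k m k' m' : ℕ)
      (ρB : Fin k → KZ.IntegralRep N) (ρS : Fin m → KZ.IntegralRep N)
      (ρB' : Fin k' → KZ.IntegralRep N) (ρS' : Fin m' → KZ.IntegralRep N)
      (cB : Fin k → ℤ) (cS : Fin m → ℤ) (cB' : Fin k' → ℤ) (cS' : Fin m' → ℤ),
      (∀ x ∈ r.domain, r.integrand x = 1) → (∀ x ∈ r'.domain, r'.integrand x = 1) →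
      (∀ i, ∀ x ∈ (ρB i).domain, (ρB i).integrand x = 1) →
      (∀ ν, ∀ x ∈ (ρS ν).domain, (ρS ν).integrand x = 1) →
      (∀ i, ∀ x ∈ (ρB' i).domain, (ρB' i).integrand x = 1) →
      (∀ ν, ∀ x ∈ (ρS' ν).domain, (ρS' ν).integrand x = 1) →
      (∀ i, cB i ≠ 0 → GB (ρB i)) → (∀ ν, cS ν ≠ 0 → GS (ρS ν)) →
      (∀ i, cB' i ≠ 0 → GB (ρB' i)) → (∀ ν, cS' ν ≠ 0 → GS (ρS' ν)) →
      (∀ᵐ x : Fin N → ℝ, r.domain.indicator (fun _ => (1 : ℝ)) x =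
        ∑ i, (cB i : ℝ) * (ρB i).domain.indicator (fun _ => (1 : ℝ)) x +
          ∑ ν, (cS ν : ℝ) * (ρS ν).domain.indicator (fun _ => (1 : ℝ)) x) →
      (∀ᵐ x : Fin N → ℝ, r'.domain.indicator (fun _ => (1 : ℝ)) x =
        ∑ i, (cB' i : ℝ) * (ρB' i).domain.indicator (fun _ => (1 : ℝ)) x +
          ∑ ν, (cS' ν : ℝ) * (ρS' ν).domain.indicator (fun _ => (1 : ℝ)) x) →
      r.value = r'.value → KZ.Equivalent r r' := by
  intro N GB GS hsc hw r r' k m k' m' ρB ρS ρB' ρS' cB cS cB' cS' hr hr' hρB hρS hρB' hρS'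
    hGB hGS hGB' hGS' hae hae' hval
  have h1 := pod_of_sub_comb_mem_relations hsc hr hρB hρS hae
  have h1' := pod_of_sub_comb_mem_relations hsc hr' hρB' hρS' hae'
  have hv := pod_value_eq_of_sub_comb_mem h1
  have hv' := pod_value_eq_of_sub_comb_mem h1'
  have h2 := pod_comb_sub_comb_mem_relations hw hGB hGS hGB' hGS' (by rw [← hv, ← hv', hval])
  have h := KZ.relations.add_mem (KZ.relations.sub_mem h1 h1') h2
  show KZ.of r - KZ.of r' ∈ KZ.relations
  convert h using 1
  abel

end Summit.KontsevichZagierPeriods.SymplecticScissors.LogPolytope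

end
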